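import Summits.QuantumFields.YangMills.Theses.ScalingWindowSplit
import Summits.QuantumFields.YangMills.Theorems.SelfNormalisedSkewness.Negative.TreeLevelSkewnessVanishes
import Literature.MathematicalPhysics.QuantumLattice.GaugeGroups
import Literature.MathematicalPhysics.QuantumLattice.GrassmannIntegral
import Literature.MathematicalPhysics.QuantumLattice.AbelianFieldTensor
import Literature.MathematicalPhysics.QuantumFieldTheory.AbelianTorusCochains
import Literature.MathematicalPhysics.QuantumFieldTheory.CircleHaarAngle
import Literature.Probability.LatticeModels.TorusGreenHessianDecay
import Literature.Probability.LatticeModels.MaxwellKernelBand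
import Literature.Probability.Distributions.GaussianCoordinateMoments

/-!
# Skeleton — crux `stmt-QuantumFields-18944` (`ScalingWindowSplit.SelfNormalisedSkewness`, W₂),
# line `Sketch`, NEGATION branch: `¬ SelfNormalisedSkewness` from the `U(1)` super-weak witness

Lead prover `prover-line-stmt-QuantumFields-18944-0`.  The crux as typed quantifies over EVERY compact
group, faithful representation and weak-coupling scheme with polynomial volumes; at `G = U(1) = Circle`,
`r = u1Rep`, along the super-weak scheme `a_k = 1/(k+1)`, `L_k = (k+1)²`, `β_k = (k+1)^s` (`s = 48`) every
hypothesis holds while the self-normalised skewness tends to `0` for every pairwise-disjoint Schwartz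
triple (`WitnessU1`), which contradicts the crux (`not_selfNormalisedSkewness_of_witnessU1`, pure logic,
from the ideator's Sketch).

Stubs (registered; each is proved as stated by one worker or by the lead):
* `stub_abelianPushforward` (A)  — Haar on `Circle^E` pushed through the real coboundary: sum over the
  period lattice `Γ` of translates = constant × Lebesgue on `V = im d` (Haar uniqueness on `V`).
* `stub_torusTwoFormExact` (B1)  — closed, zero-mean real 2-cochains on `(ℤ/S)⁴` are exact.
* `stub_rangeProjectionKernel` (B2) — the orthogonal projection onto `im d` has kernel `½ K(Hess G̃)`.
* `stub_torusGreenThirdDiff` (C) — third differences of the torus Green function `≤ C (dist⁻⁵ + L⁻⁴)`.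
* `stub_wickSquares` (D)  — covariance / third moment of Gaussian Wick squares.
* `stub_flatNearDisjointSupports` (E) — Schwartz flatness at disjoint supports.
* `stub_witnessAssembly` (F, lead) — A ∧ … ∧ E ⇒ `WitnessU1`.
-/

noncomputable section

open scoped BigOperators Topology ENNReal InnerProductSpace
open Filter Set MeasureTheory ProbabilityTheory
open Literature.MathematicalPhysics.QuantumLattice Literature.MathematicalPhysics.AQFT
  Literature.MathematicalPhysics.QuantumFieldTheory
open Literature.Probability.LatticeModels (TorusSite torusGreen)

namespace Summit.QuantumFields.YangMills.Theorems.SelfNormalisedSkewness.Negative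

/-- Euclidean `ℝ⁴`. [folklore] -/
abbrev E4 : Type := EuclideanSpace ℝ (Fin 4)

section Vocabulary

variable {G : Type} [Group G] [TopologicalSpace G] [IsTopologicalGroup G] [CompactSpace G]
  [MeasurableSpace G] [BorelSpace G]

/-- The crux's BARE scheme (`c ≡ 1`, `m ≡ 0`). [folklore] -/
def bare (sch : SpeciesScheme (YMSpecies G)) : SpeciesScheme (YMSpecies G) :=
  { sch with c := fun _ _ => 1, m := fun _ _ => 0 }

/-- The crux's `T w k`: bare truncated plaquette two-point function at the reflected pair `(w, θw)`.
[folklore] -/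
def Tbare (r : LatticeRep G) (sch : SpeciesScheme (YMSpecies G)) (w : SchwartzMap E4 ℝ) (k : ℕ) : ℝ :=
  latticeSchwinger r.ρ (bare sch) (fun s => s.F) k (1 + 1) (fun _ => r.curvature) ![w, thetaTest 4 w] -
    latticeSchwinger r.ρ (bare sch) (fun s => s.F) k 1 (fun _ => r.curvature) ![w] *
      latticeSchwinger r.ρ (bare sch) (fun s => s.F) k 1 (fun _ => r.curvature) ![thetaTest 4 w]

/-- The crux's SELF-NORMALISED scheme `canon` (`c'_k = 1/√T_k(u)`, `m'_k = ⟨F⟩_k`). [folklore] -/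
def canon (r : LatticeRep G) (sch : SpeciesScheme (YMSpecies G)) (u : SchwartzMap E4 ℝ) :
    SpeciesScheme (YMSpecies G) :=
  { sch with c := fun _ k => (Real.sqrt (Tbare r sch u k))⁻¹,
             m := fun _ k => ∫ U, r.curvature.F (torusLift (sch.side k) U) ∂(wilsonMeasure r.ρ (sch.β k)) }

/-- The crux's self-normalised third cumulant `κ₃^canon_k(f, g, h)`. [folklore] -/
def kappa3 (r : LatticeRep G) (sch : SpeciesScheme (YMSpecies G)) (u f g h : SchwartzMap E4 ℝ)
    (k : ℕ) : ℝ :=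
  let S : (n : ℕ) → (Fin n → SchwartzMap E4 ℝ) → ℝ :=
    fun n w => latticeSchwinger r.ρ (canon r sch u) (fun s => s.F) k n (fun _ => r.curvature) w
  S 3 ![f, g, h] - S 1 ![f] * S 2 ![g, h] - S 1 ![g] * S 2 ![f, h] - S 1 ![h] * S 2 ![f, g] +
    2 * (S 1 ![f] * S 1 ![g] * S 1 ![h])

/-- The crux's hypothesis block: weak coupling, polynomial volumes, past support of `u`,
floor ∧ window at `u`. [folklore] -/
def Hyps (r : LatticeRep G) (sch : SpeciesScheme (YMSpecies G)) (u : SchwartzMap E4 ℝ) (p : ℕ)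
    (M : ℝ) : Prop :=
  sch.HasWeakCouplingLimit ∧
    (∃ N : ℕ, 1 ≤ N ∧ ∀ᶠ k in atTop, (sch.a k)⁻¹ ≤ (sch.a k * (sch.L k : ℝ)) ^ N) ∧
      tsupport u ⊆ {y : E4 | y 0 < 0} ∧
        ∀ᶠ k in atTop, (sch.a k) ^ p ≤ Tbare r sch u k ∧
          Tbare r sch u k ≤ M * Tbare r sch (timeShiftTest 4 (-1) u) k

end Vocabulary

/-- **The `U(1)` super-weak witness** (negation line, cards `superweak-abelian-laplace` /
`ultraweak-abelian-laplace`): data `(r, sch, u, p, M)` at `G = Circle` meeting every hypothesis of the crux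
while `κ₃^canon_k(f,g,h) → 0` for every pairwise-disjoint Schwartz triple. [folklore] -/
def WitnessU1 : Prop :=
  ∃ (r : LatticeRep Circle) (sch : SpeciesScheme (YMSpecies Circle)) (u : SchwartzMap E4 ℝ) (p : ℕ)
    (M : ℝ), Hyps r sch u p M ∧
      ∀ f g h : SchwartzMap E4 ℝ, Disjoint (tsupport f) (tsupport g) → Disjoint (tsupport f) (tsupport h) →
        Disjoint (tsupport g) (tsupport h) → Tendsto (kappa3 r sch u f g h) atTop (𝓝 0)

/-- **The kill is pure logic**: `WitnessU1 → ¬ W₂` (instantiate the crux at `G = Circle` and the witness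
data; its `δ`-floor contradicts `κ₃ → 0`).  From the ideator's Sketch (crux dir `SketchIdeator2.lean`).
[folklore] -/
theorem not_selfNormalisedSkewness_of_witnessU1 (hW : WitnessU1) :
    ¬ Summit.QuantumFields.YangMills.Theses.ScalingWindowSplit.SelfNormalisedSkewness := by
  intro hS
  obtain ⟨r, sch, u, p, M, ⟨hweak, hvol, hsupp, hfw⟩, hlim⟩ := hW
  have h := hS Circle r sch u p M hweak hvol hsupp hfw
  obtain ⟨f, g, h3, δ, hfg, hfh, hgh, hδ, hev⟩ := h
  have hev' : ∀ᶠ k in atTop, δ ≤ |kappa3 r sch u f g h3 k| := hev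
  have hsmall : ∀ᶠ k in atTop, |kappa3 r sch u f g h3 k| < δ := by
    have ht := hlim f g h3 hfg hfh hgh
    have := (Metric.tendsto_nhds.1 ht) δ hδ
    refine this.mono fun k hk => ?_
    simpa [Real.dist_eq] using hk
  obtain ⟨k, hk₁, hk₂⟩ := (hev'.and hsmall).exists
  exact absurd hk₁ (not_le.2 hk₂)

/-! ## The stubs -/

/-- **Stub A — abelian pushforward of Haar under an integer linear map.**  For finite index types `E`
(links) and `P` (plaquettes), an `ℝ`-linear map `d : ℝ^E → ℝ^P` with INTEGER coefficients `n`, and the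
product Haar probability on `Circle^E`: writing `ρ U := d (arg ∘ U) ∈ V := im d` and
`Γ := {γ ∈ V | γ_p ∈ 2πℤ ∀ p}` (the period lattice), the `Γ`-periodised law of `ρ` is a constant multiple of
Lebesgue measure on the subspace `V` (uniqueness of Haar measure on `V`; the sum over `Γ` is exactly
translation invariant because `arg (z w) ≡ arg z + arg w (mod 2π)` and `d (2πℤ^E) ⊆ Γ`). [folklore] -/
theorem stub_abelianPushforward {E P : Type} [Fintype E] [DecidableEq E] [Fintype P] [DecidableEq P]
    (n : P → E → ℤ) (d : (E → ℝ) →ₗ[ℝ] EuclideanSpace ℝ P)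
    (hd : ∀ (θ : E → ℝ) (p : P), d θ p = ∑ e, (n p e : ℝ) * θ e) :
    ∃ c : ℝ≥0∞, c ≠ 0 ∧ c ≠ ∞ ∧
      ∀ F : LinearMap.range d → ℝ≥0∞, Measurable F →
        ∫⁻ U : E → Circle,
            (∑' γ : {v : LinearMap.range d // ∀ p : P, ∃ m : ℤ, (v : EuclideanSpace ℝ P) p = 2 * Real.pi * m},
              F (⟨d (fun e => Complex.arg (U e : ℂ)), LinearMap.mem_range_self d _⟩ + (γ : LinearMap.range d)))
          ∂(Measure.pi fun _ : E => haarProbability Circle) =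
        c * ∫⁻ v : LinearMap.range d, F v := by
  sorry


/-- The mixed second difference ("Hessian") of the zero-mode-free torus Green function
`G̃_L = torusGreen` of `(ℤ/Lℤ)⁴`: `Hess_{ij}(z) = G̃(z+eᵢ) - G̃(z+eᵢ-eⱼ) - G̃(z) + G̃(z-eⱼ) = ∇ᵢ⁺∇ⱼ⁻G̃(z)`
(the combination bounded in `torusGreen_hessian_mul_dist_pow_four_le`). [folklore] -/
def greenHess {L : ℕ} [NeZero L] (z : TorusSite 4 L) (i j : Fin 4) : ℝ :=
  torusGreen (z + Pi.single i 1) - torusGreen (z + Pi.single i 1 - Pi.single j 1) -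
    torusGreen z + torusGreen (z - Pi.single j 1)

/-- **Stub B1 — closed, zero-mean real 2-cochains on the discrete 4-torus are exact.**  If an alternating
real plaquette field `ω` on `(ℤ/S)⁴` has vanishing cube flux (`td₂ ω = 0`, Bianchi) and vanishing total
sum in each of the six orientations (no torus flux), then `ω = td₁ θ` for a real link field `θ`.
(Torus Fourier transform: at momentum `k ≠ 0` the Koszul complex of `K(k) = (e^{ip_μ}-1)_μ` is exact —
`AA* + B*B = |K|²·1` on 2-forms — and `k = 0` is exactly the total-sum condition.) [folklore] -/
theorem stub_torusTwoFormExact (S : ℕ) [NeZero S] (ω : Site 4 S → Fin 4 → Fin 4 → ℝ)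
    (halt : LatticeForm.IsAlt ω) (hclosed : LatticeForm.td₂ ω = 0)
    (hflux : ∀ μ ν : Fin 4, ∑ x : Site 4 S, ω x μ ν = 0) :
    ∃ θ : Site 4 S → Fin 4 → ℝ, LatticeForm.td₁ θ = ω := by
  sorry

/-- **Stub B2 — the kernel of the orthogonal projection onto exact plaquette fields.**  For the real
plaquette coboundary `d` of `(ℤ/S)⁴` (as a linear map into `ℝ^{Plaquette 4 S}` with its Euclidean inner
product), the orthogonal projection onto `im d` — the covariance of the unit lattice-Maxwell Gaussian — has
matrix elements `⟪Π e_p, e_q⟫ = ½ K(Hess G̃(x_p - x_q))_{α_p α_q}` with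
`K(h)_{(μν),(ρσ)} = -h_{μρ}δ_{νσ} + h_{μσ}δ_{νρ} + h_{νρ}δ_{μσ} - h_{νσ}δ_{μρ}` and `Hess = greenHess`
(torus Fourier: the multiplier is `A A*/|K|²`, `A = d̂(k) = K∧`, and
`L⁻⁴∑_{k≠0} e^{ikn} K_μ K̄_ρ/|K|² = -½ ∇⁺_μ∇⁻_ρ G̃(n)`). [folklore] -/
theorem stub_rangeProjectionKernel (S : ℕ) [NeZero S]
    (d : (Edge 4 S → ℝ) →ₗ[ℝ] EuclideanSpace ℝ (Plaquette 4 S))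
    (hd : ∀ (θ : Edge 4 S → ℝ) (x : Site 4 S) (q : {q : Fin 4 × Fin 4 // q.1 < q.2}),
      d θ (x, q) = θ (x, q.1.1) + θ (x + Pi.single q.1.1 1, q.1.2) - θ (x + Pi.single q.1.2 1, q.1.1) -
        θ (x, q.1.2))
    (p q : Plaquette 4 S) :
    ⟪(LinearMap.range d).starProjection (EuclideanSpace.single p (1 : ℝ)),
        EuclideanSpace.single q (1 : ℝ)⟫_ℝ =
      (1 / 2 : ℝ) *
        (-(torusGreen ((p.1 - q.1 : TorusSite 4 S) + Pi.single p.2.1.1 1) - torusGreen ((p.1 - q.1 : TorusSite 4 S) + Pi.single p.2.1.1 1 - Pi.single q.2.1.1 1) - torusGreen ((p.1 - q.1 : TorusSite 4 S)) + torusGreen ((p.1 - q.1 : TorusSite 4 S) - Pi.single q.2.1.1 1)) *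
            (if p.2.1.2 = q.2.1.2 then 1 else 0)
        + (torusGreen ((p.1 - q.1 : TorusSite 4 S) + Pi.single p.2.1.1 1) - torusGreen ((p.1 - q.1 : TorusSite 4 S) + Pi.single p.2.1.1 1 - Pi.single q.2.1.2 1) - torusGreen ((p.1 - q.1 : TorusSite 4 S)) + torusGreen ((p.1 - q.1 : TorusSite 4 S) - Pi.single q.2.1.2 1)) *
            (if p.2.1.2 = q.2.1.1 then 1 else 0)
        + (torusGreen ((p.1 - q.1 : TorusSite 4 S) + Pi.single p.2.1.2 1) - torusGreen ((p.1 - q.1 : TorusSite 4 S) + Pi.single p.2.1.2 1 - Pi.single q.2.1.1 1) - torusGreen ((p.1 - q.1 : TorusSite 4 S)) + torusGreen ((p.1 - q.1 : TorusSite 4 S) - Pi.single q.2.1.1 1)) *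
            (if p.2.1.1 = q.2.1.2 then 1 else 0)
        - (torusGreen ((p.1 - q.1 : TorusSite 4 S) + Pi.single p.2.1.2 1) - torusGreen ((p.1 - q.1 : TorusSite 4 S) + Pi.single p.2.1.2 1 - Pi.single q.2.1.2 1) - torusGreen ((p.1 - q.1 : TorusSite 4 S)) + torusGreen ((p.1 - q.1 : TorusSite 4 S) - Pi.single q.2.1.2 1)) *
            (if p.2.1.1 = q.2.1.1 then 1 else 0)) := by
  sorry

/-- **Stub C — third differences of the four-torus Green function decay like `dist⁻⁵`, up to the
zero-mode background `L⁻⁴`.**  For all `L`, directions `i j k` and `z ≠ 0` in `(ℤ/L)⁴`,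
`|Hess_{ij}(z) - Hess_{ij}(z - e_k)| ≤ C (dist(0,z)⁻⁵ + L⁻⁴)` with an absolute constant `C`
(`dist² = ∑_μ valMinAbs(z_μ)²`; heat-kernel chain of `TorusGreenHessianDecay` with one more one-dimensional
difference factor, tails `≤ C L⁻⁴` as there). [folklore] -/
theorem stub_torusGreenThirdDiff : ∃ C : ℝ, ∀ (L : ℕ) [NeZero L] (i j k : Fin 4)
    (z : TorusSite 4 L), z ≠ 0 →
      |(torusGreen (z + Pi.single i 1) - torusGreen (z + Pi.single i 1 - Pi.single j 1) - torusGreen (z) + torusGreen (z - Pi.single j 1)) -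
          (torusGreen ((z - Pi.single k 1 : TorusSite 4 L) + Pi.single i 1) - torusGreen ((z - Pi.single k 1 : TorusSite 4 L) + Pi.single i 1 - Pi.single j 1) - torusGreen ((z - Pi.single k 1 : TorusSite 4 L)) + torusGreen ((z - Pi.single k 1 : TorusSite 4 L) - Pi.single j 1))| ≤
        C * ((Real.sqrt (∑ μ, (((z μ).valMinAbs : ℤ) : ℝ) ^ 2) ^ 5)⁻¹ + ((L : ℝ) ^ 4)⁻¹) := by
  sorry

/-- **Stub D — Gaussian Wick squares: covariance and third moment.**  For the standard Gaussian `γ` of a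
finite-dimensional real inner product space and vectors `a b c`, the centred squares
`⟪a,x⟫² - ‖a‖²` satisfy `E[(A²-|a|²)(B²-|b|²)] = 2⟪a,b⟫²` and
`E[(A²-|a|²)(B²-|b|²)(C²-|c|²)] = 8⟪a,b⟫⟪b,c⟫⟪c,a⟫` (Isserlis), and products of at most six linear
functionals are integrable. [folklore] -/
theorem stub_wickSquares {W : Type} [NormedAddCommGroup W] [InnerProductSpace ℝ W] [FiniteDimensional ℝ W]
    [MeasurableSpace W] [BorelSpace W] :
    (∀ (m : ℕ) (v : Fin m → W), m ≤ 6 → Integrable (fun x : W => ∏ i, ⟪v i, x⟫_ℝ) (stdGaussian W)) ∧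
    (∀ a b : W, ∫ x, (⟪a, x⟫_ℝ ^ 2 - ‖a‖ ^ 2) * (⟪b, x⟫_ℝ ^ 2 - ‖b‖ ^ 2) ∂(stdGaussian W) =
        2 * ⟪a, b⟫_ℝ ^ 2) ∧
    (∀ a b c : W, ∫ x, (⟪a, x⟫_ℝ ^ 2 - ‖a‖ ^ 2) * (⟪b, x⟫_ℝ ^ 2 - ‖b‖ ^ 2) * (⟪c, x⟫_ℝ ^ 2 - ‖c‖ ^ 2)
          ∂(stdGaussian W) = 8 * (⟪a, b⟫_ℝ * ⟪b, c⟫_ℝ * ⟪c, a⟫_ℝ)) := by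
  sorry

/-- **Stub E — Schwartz flatness at disjoint supports.**  If `f, g ∈ 𝓢(ℝ⁴)` have disjoint topological
supports then `f` vanishes to infinite order wherever `g ≠ 0`, quantitatively and with Schwartz decay:
`|f x| (1 + ‖x‖)^M ≤ C ‖x - y‖^N` whenever `g y ≠ 0` (Taylor's theorem along the segment, all derivatives
of `f` vanish on `tsupport g ⊆ (tsupport f)ᶜ`). [folklore] -/
theorem stub_flatNearDisjointSupports (f g : SchwartzMap E4 ℝ) (hfg : Disjoint (tsupport f) (tsupport g))
    (N M : ℕ) : ∃ C : ℝ, 0 ≤ C ∧ ∀ x y : E4, g y ≠ 0 → |f x| * (1 + ‖x‖) ^ M ≤ C * ‖x - y‖ ^ N := by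
  sorry


/-! ## The stub statements as propositions (hypotheses of the lead's assembly stub) -/

/-- Statement of Stub A. [folklore] -/
def StubPushforward : Prop :=
  ∀ {E P : Type} [Fintype E] [DecidableEq E] [Fintype P] [DecidableEq P]
    (n : P → E → ℤ) (d : (E → ℝ) →ₗ[ℝ] EuclideanSpace ℝ P),
    (∀ (θ : E → ℝ) (p : P), d θ p = ∑ e, (n p e : ℝ) * θ e) →
    ∃ c : ℝ≥0∞, c ≠ 0 ∧ c ≠ ∞ ∧
      ∀ F : LinearMap.range d → ℝ≥0∞, Measurable F →
        ∫⁻ U : E → Circle,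
            (∑' γ : {v : LinearMap.range d // ∀ p : P, ∃ m : ℤ, (v : EuclideanSpace ℝ P) p = 2 * Real.pi * m},
              F (⟨d (fun e => Complex.arg (U e : ℂ)), LinearMap.mem_range_self d _⟩ + (γ : LinearMap.range d)))
          ∂(Measure.pi fun _ : E => haarProbability Circle) =
        c * ∫⁻ v : LinearMap.range d, F v

/-- Statement of Stub B1. [folklore] -/
def StubExact : Prop :=
  ∀ (S : ℕ) [NeZero S] (ω : Site 4 S → Fin 4 → Fin 4 → ℝ),
    LatticeForm.IsAlt ω → LatticeForm.td₂ ω = 0 → (∀ μ ν : Fin 4, ∑ x : Site 4 S, ω x μ ν = 0) →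
    ∃ θ : Site 4 S → Fin 4 → ℝ, LatticeForm.td₁ θ = ω

/-- Statement of Stub B2. [folklore] -/
def StubProjection : Prop :=
  ∀ (S : ℕ) [NeZero S] (d : (Edge 4 S → ℝ) →ₗ[ℝ] EuclideanSpace ℝ (Plaquette 4 S)),
    (∀ (θ : Edge 4 S → ℝ) (x : Site 4 S) (q : {q : Fin 4 × Fin 4 // q.1 < q.2}),
      d θ (x, q) = θ (x, q.1.1) + θ (x + Pi.single q.1.1 1, q.1.2) - θ (x + Pi.single q.1.2 1, q.1.1) -
        θ (x, q.1.2)) →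
    ∀ p q : Plaquette 4 S,
    ⟪(LinearMap.range d).starProjection (EuclideanSpace.single p (1 : ℝ)),
        EuclideanSpace.single q (1 : ℝ)⟫_ℝ =
      (1 / 2 : ℝ) *
        (-(torusGreen ((p.1 - q.1 : TorusSite 4 S) + Pi.single p.2.1.1 1) - torusGreen ((p.1 - q.1 : TorusSite 4 S) + Pi.single p.2.1.1 1 - Pi.single q.2.1.1 1) - torusGreen ((p.1 - q.1 : TorusSite 4 S)) + torusGreen ((p.1 - q.1 : TorusSite 4 S) - Pi.single q.2.1.1 1)) *
            (if p.2.1.2 = q.2.1.2 then 1 else 0)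
        + (torusGreen ((p.1 - q.1 : TorusSite 4 S) + Pi.single p.2.1.1 1) - torusGreen ((p.1 - q.1 : TorusSite 4 S) + Pi.single p.2.1.1 1 - Pi.single q.2.1.2 1) - torusGreen ((p.1 - q.1 : TorusSite 4 S)) + torusGreen ((p.1 - q.1 : TorusSite 4 S) - Pi.single q.2.1.2 1)) *
            (if p.2.1.2 = q.2.1.1 then 1 else 0)
        + (torusGreen ((p.1 - q.1 : TorusSite 4 S) + Pi.single p.2.1.2 1) - torusGreen ((p.1 - q.1 : TorusSite 4 S) + Pi.single p.2.1.2 1 - Pi.single q.2.1.1 1) - torusGreen ((p.1 - q.1 : TorusSite 4 S)) + torusGreen ((p.1 - q.1 : TorusSite 4 S) - Pi.single q.2.1.1 1)) *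
            (if p.2.1.1 = q.2.1.2 then 1 else 0)
        - (torusGreen ((p.1 - q.1 : TorusSite 4 S) + Pi.single p.2.1.2 1) - torusGreen ((p.1 - q.1 : TorusSite 4 S) + Pi.single p.2.1.2 1 - Pi.single q.2.1.2 1) - torusGreen ((p.1 - q.1 : TorusSite 4 S)) + torusGreen ((p.1 - q.1 : TorusSite 4 S) - Pi.single q.2.1.2 1)) *
            (if p.2.1.1 = q.2.1.1 then 1 else 0))

/-- Statement of Stub C. [folklore] -/
def StubThirdDiff : Prop :=
  ∃ C : ℝ, ∀ (L : ℕ) [NeZero L] (i j k : Fin 4) (z : TorusSite 4 L), z ≠ 0 →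
      |(torusGreen (z + Pi.single i 1) - torusGreen (z + Pi.single i 1 - Pi.single j 1) - torusGreen (z) + torusGreen (z - Pi.single j 1)) -
          (torusGreen ((z - Pi.single k 1 : TorusSite 4 L) + Pi.single i 1) - torusGreen ((z - Pi.single k 1 : TorusSite 4 L) + Pi.single i 1 - Pi.single j 1) - torusGreen ((z - Pi.single k 1 : TorusSite 4 L)) + torusGreen ((z - Pi.single k 1 : TorusSite 4 L) - Pi.single j 1))| ≤
        C * ((Real.sqrt (∑ μ, (((z μ).valMinAbs : ℤ) : ℝ) ^ 2) ^ 5)⁻¹ + ((L : ℝ) ^ 4)⁻¹)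

/-- Statement of Stub D. [folklore] -/
def StubWick : Prop :=
  ∀ {W : Type} [NormedAddCommGroup W] [InnerProductSpace ℝ W] [FiniteDimensional ℝ W]
    [MeasurableSpace W] [BorelSpace W],
    (∀ (m : ℕ) (v : Fin m → W), m ≤ 6 → Integrable (fun x : W => ∏ i, ⟪v i, x⟫_ℝ) (stdGaussian W)) ∧
    (∀ a b : W, ∫ x, (⟪a, x⟫_ℝ ^ 2 - ‖a‖ ^ 2) * (⟪b, x⟫_ℝ ^ 2 - ‖b‖ ^ 2) ∂(stdGaussian W) =
        2 * ⟪a, b⟫_ℝ ^ 2) ∧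
    (∀ a b c : W, ∫ x, (⟪a, x⟫_ℝ ^ 2 - ‖a‖ ^ 2) * (⟪b, x⟫_ℝ ^ 2 - ‖b‖ ^ 2) * (⟪c, x⟫_ℝ ^ 2 - ‖c‖ ^ 2)
          ∂(stdGaussian W) = 8 * (⟪a, b⟫_ℝ * ⟪b, c⟫_ℝ * ⟪c, a⟫_ℝ))

/-- Statement of Stub E. [folklore] -/
def StubFlat : Prop :=
  ∀ (f g : SchwartzMap E4 ℝ), Disjoint (tsupport f) (tsupport g) → ∀ (N M : ℕ),
    ∃ C : ℝ, 0 ≤ C ∧ ∀ x y : E4, g y ≠ 0 → |f x| * (1 + ‖x‖) ^ M ≤ C * ‖x - y‖ ^ N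

/-- **Stub F (lead) — assembly of the witness.**  From A (pushforward), B1 (no flux ⇒ the small-field set is
a chart of `V`), B2 (Gaussian covariance = `½K(Hess G̃)`), C (antisymmetric part of `Hess` is `O(dist⁻⁵)`),
D (Wick squares) and E (flatness), together with the tree's `torusGreen_hessian_mul_dist_pow_four_le`,
`maxwellKernel_axis_band` and `treeLevelSkewness_vanishes`: the super-weak `U(1)` scheme
(`a_k = 1/(k+1)`, `L_k = (k+1)²`, `β_k = (k+1)^48`, bump `u` at time `-2`, `p = 105`) satisfies `Hyps` and has
`κ₃^canon → 0` for every disjoint triple — large fields cost `e^{-β^{1/4}/4}` against an entropy `e^{O(L⁴ log β)}`,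
on small fields Wilson's weight is sandwiched between Gaussians (`0 ≤ cos x - 1 + x²/2 ≤ x⁴/24`) with an
absolute `o(a^{20})` defect, the Gaussian third cumulant of the `O(4)`-scalar composite is
`⅛ tr K(H₁)K(H₂)K(H₃) = O(dist⁻⁵·dist⁻⁴·dist⁻⁴ + L⁻⁴ dist⁻⁸)`, hence `O(a log(1/a))` after smearing against a
disjoint Schwartz triple, while the two-point function is `≍ β⁻² a⁸` (cone around the time axis). [folklore] -/
theorem stub_witnessAssembly (hA : StubPushforward) (hB1 : StubExact) (hB2 : StubProjection)
    (hC : StubThirdDiff) (hD : StubWick) (hE : StubFlat) : WitnessU1 := by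
  sorry

/-- **`SelfNormalisedSkewness` (W₂ of route `ScalingWindowSplit`) is false as typed**: the group-blind,
gap-free `∀`-statement fails at `G = U(1)` along a super-weak-coupling scheme, where every hypothesis holds
and the self-normalised skewness of `tr F²` tends to `0` (its tree-level value vanishes in `d = 4`,
`treeLevelSkewness_vanishes`).  The repair is the gapped restatement C′ (`HasLatticeMassGap`). [folklore] -/
theorem not_SelfNormalisedSkewness :
    ¬ Summit.QuantumFields.YangMills.Theses.ScalingWindowSplit.SelfNormalisedSkewness :=
  not_selfNormalisedSkewness_of_witnessU1
    (stub_witnessAssembly (fun n d hd => stub_abelianPushforward n d hd)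
      (fun S _ ω h1 h2 h3 => stub_torusTwoFormExact S ω h1 h2 h3)
      (fun S _ d hd p q => stub_rangeProjectionKernel S d hd p q) stub_torusGreenThirdDiff
      (fun {W} _ _ _ _ _ => stub_wickSquares) stub_flatNearDisjointSupports)

end Summit.QuantumFields.YangMills.Theorems.SelfNormalisedSkewness.Negative

end
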